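import Summits.QuantumFields.YangMills.Theses.BalabanUVNodes

/-!
# Route BalabanUVNodes — the assembly item, closed by the route's deciding theorem

`Summit.QuantumFields.YangMills.Theses.BalabanUVNodes.Assembly` is the registered assembly statement
`StabilityBAtRecord → EndpointGivenB → SpineGivenEndpoint → BalabanLadder.UV` (item stmt-QuantumFields-19184,
rank 1 of route-QuantumFields-BalabanUVNodes).  It is literally the curried form of the route file's
planner-authored deciding theorem `BalabanUVNodes.closes`; this file records that fact as a sorry-free term so the
item closes by name.  HONEST FRAMING: pure bookkeeping (the three cruxes remain the route's open content);
one finite four-torus programme at fixed ε; nothing continuum ∕ ℝ⁴ ∕ OS ∕ mass gap ∕ Clay.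
-/

namespace Summit.QuantumFields.YangMills.Theorems

/-- The assembly item of route BalabanUVNodes: the three cruxes `StabilityBAtRecord`, `EndpointGivenB`,
`SpineGivenEndpoint` imply the rung leaf `BalabanLadder.UV` — by the route's deciding theorem
`BalabanUVNodes.closes` (for each four-torus family `F`: `hS F (hE F (hB F))`). -/
theorem BalabanUVNodes_Assembly_proof :
    Summit.QuantumFields.YangMills.Theses.BalabanUVNodes.Assembly := by
  unfold Summit.QuantumFields.YangMills.Theses.BalabanUVNodes.Assembly
  intro hB hE hS F
  -- rev ≥ 6 of the route file re-keyed `BalabanUVNodes.closes` on the ₁₁C four (Record11Inhabited, …R11e, …R11),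
  -- so the rev-0 chain is composed directly: `SpineGivenEndpoint`'s conclusion at `F` is `BalabanLadder.UV`'s body at `F`.
  exact hS F (hE F (hB F))

end Summit.QuantumFields.YangMills.Theorems
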